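import Summits.PneNP.PneNP.Theorems.SymmetryBudgetWindowBarrierEntropyGameColouringTypes

/-!
# Colouring robustness of the entropy game
(dichotomy `WindowBarrier` stmt-PneNP-2145 / `NoHiddenOrder` stmt-PneNP-14781, route `PneNP/SymmetryBudget`)

`SymmetryBudgetWindowBarrierEntropyGamePebble.lean` extracts Hella's bijective `k`-pebble game from an
entropy-`K` game (types "`k` singletons and one block").  Here the one block is replaced by the classes
of an ARBITRARY low-entropy vertex colouring `c` of `G`: Duplicator must answer it (one block move) with
a colouring `c ∘ π⁻¹` of `H` (same class sizes), after which the pebble extraction runs inside the colour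
classes (types `CosetGame.colMu`, file `…EntropyGameColouringTypes.lean`).  Consequently an entropy game
survives every colouring with `2^{O(1)}` colours followed by `Θ(n / log n)` bijective pebble rounds — the
form in which candidate witness families for `HardToIdentify` are tested (a Cai–Fürer–Immerman pair dies at
once: colour a section of the untwisted graph, then three pebbles expose the parity defect).

* **`CosetGame.exists_colourStrategy_of_relInf`**, **`CosetGame.exists_colourStrategy_of_entropyGame`** —
  an entropy-`K` game and a colouring `c` of `V(G)` with `n!·n^k ≤ 2^{Kn}·|classStab c|` yield a vertex
  bijection `π` and a bijective `k`-pebble strategy all of whose positions respect the colourings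
  `c` of `G` and `c ∘ π⁻¹` of `H`.
* **`CosetGame.colourRobust_of_entropyGame`** — the instance `K = K₁ + K₂`: colourings of entropy `≤ K₁ n`,
  `K₂ n / (log₂ n + 1)` pebbles; `CosetGame.not_nonempty_entropyGame_of_colouring` — Spoiler's recipe (contrapositive); **`CosetGame.colourRobust_of_hardToIdentify`** — HardToIdentify (the open
  core of stmt-PneNP-2145) forces, for all `K₁ K₂`, infinitely many non-isomorphic pairs that stay
  `C^{K₂ n/(log₂ n+1)}`-equivalent after ANY vertex colouring of entropy `≤ K₁ n` of the first graph,
  transported to the second along the answered bijection.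
-/

-- `Summit.PneNP.PneNP.…` duplicates `PneNP` BY DESIGN (single-problem summit).
set_option linter.dupNamespace false

namespace Summit.PneNP.PneNP.Theorems

open Finset Filter Literature.Computability.Complexity Literature.ModelTheory.FiniteModelTheory
open scoped Classical

namespace CosetGame

variable {n K : ℕ}

noncomputable section

/-! ### The colour-respecting pebble strategy -/

/-- **The point clause at pebbled slots** of a colour-refined pebble type. -/
theorem RelInf.adj_iff_col {χ : Fin n → ℕ} {I : Finset (Fin n)} {G H : SimpleGraph (Fin n)}
    {β γ : Equiv.Perm (Fin n)} (h : RelInf K (blockGroup (colMu χ I)) G β H γ) {i j : Fin n}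
    (hi : i ∈ I) (hj : j ∈ I) : G.Adj (β i) (β j) ↔ H.Adj (γ i) (γ j) := by
  obtain ⟨e, he⟩ := (h 1).2.2 (i, j)
  have h1 := he 1
  simp only [OneMemClass.coe_one, mul_one, Equiv.Perm.mul_apply] at h1
  rwa [apply_eq_of_mem_blockGroup_colMu (e 1).2 hi, apply_eq_of_mem_blockGroup_colMu (e 1).2 hj] at h1

section Strategy

variable (K) (k : ℕ) (G H : SimpleGraph (Fin n)) (c d χ : Fin n → ℕ)

/-- The colour-respecting pebble positions: images of the pebbled slots of a colour-refined pebble type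
under a limit-related pair of positions that carry the slot colouring `χ` to the vertex colourings
`c` of `G` and `d` of `H`. -/
def colCarrier : Set (Set (Fin n × Fin n)) :=
  {p | ∃ I : Finset (Fin n), I.card ≤ k ∧ ∃ β γ : Equiv.Perm (Fin n),
    p = ((I.image fun i => (β i, γ i) : Finset (Fin n × Fin n)) : Set (Fin n × Fin n)) ∧
      RelInf K (blockGroup (colMu χ I)) G β H γ ∧ (∀ i, c (β i) = χ i) ∧ ∀ i, d (γ i) = χ i}

variable {K k G H c d χ}

/-- **Positions respect the colourings.** -/
theorem colour_eq_of_mem_colCarrier {p : Set (Fin n × Fin n)} (hp : p ∈ colCarrier K k G H c d χ)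
    {x : Fin n × Fin n} (hx : x ∈ p) : c x.1 = d x.2 := by
  obtain ⟨I, -, β, γ, rfl, -, hc, hd⟩ := hp
  obtain ⟨i, -, rfl⟩ := Finset.mem_image.1 (Finset.mem_coe.1 hx)
  rw [hc i, hd i]

/-- Positions are partial isomorphisms. -/
theorem isPartialIso_of_mem_colCarrier {p : Set (Fin n × Fin n)} (hp : p ∈ colCarrier K k G H c d χ) :
    IsPartialIso G H p := by
  obtain ⟨I, -, β, γ, rfl, hR, -, -⟩ := hp
  refine ⟨fun x hx y hy => ?_, fun x hx y hy => ?_⟩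
  · obtain ⟨i, -, rfl⟩ := Finset.mem_image.1 (Finset.mem_coe.1 hx)
    obtain ⟨j, -, rfl⟩ := Finset.mem_image.1 (Finset.mem_coe.1 hy)
    exact β.injective.eq_iff.trans γ.injective.eq_iff.symm
  · obtain ⟨i, hi, rfl⟩ := Finset.mem_image.1 (Finset.mem_coe.1 hx)
    obtain ⟨j, hj, rfl⟩ := Finset.mem_image.1 (Finset.mem_coe.1 hy)
    show G.Adj (β i) (β j) ↔ H.Adj (γ i) (γ j)
    exact RelInf.adj_iff_col hR hi hj

/-- Sub-positions are positions (lift pebbles: block move to the sub-type, at `ρ = 1`). -/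
theorem mem_colCarrier_of_subset (hk : n.factorial * n ^ k ≤ 2 ^ (K * n) * Nat.card (classStab χ))
    {p : Set (Fin n × Fin n)} (hp : p ∈ colCarrier K k G H c d χ) {q : Set (Fin n × Fin n)} (hq : q ⊆ p) :
    q ∈ colCarrier K k G H c d χ := by
  obtain ⟨I, hI, β, γ, rfl, hR, hc, hd⟩ := hp
  set J : Finset (Fin n) := I.filter fun i => (β i, γ i) ∈ q with hJ
  have hJI : J ⊆ I := Finset.filter_subset _ _
  have hJk : J.card ≤ k := (Finset.card_le_card hJI).trans hI
  have hT : IsType K (blockGroup (colMu χ J)) := isType_blockGroup (isLowEntropy_colMu hk hJk)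
  obtain ⟨e, he⟩ := RelInf.step hT hR
  refine ⟨J, hJk, _, _, ?_, he 1, fun i => ?_, fun i => ?_⟩
  · ext x
    constructor
    · intro hx
      obtain ⟨i, hi, rfl⟩ := Finset.mem_image.1 (Finset.mem_coe.1 (hq hx))
      refine Finset.mem_coe.2 (Finset.mem_image.2 ⟨i, Finset.mem_filter.2 ⟨hi, hx⟩, ?_⟩)
      simp only [OneMemClass.coe_one, mul_one, Equiv.Perm.mul_apply]
      rw [apply_eq_of_mem_blockGroup_colMu (e 1).2 hi]
    · intro hx
      obtain ⟨i, hi, rfl⟩ := Finset.mem_image.1 (Finset.mem_coe.1 hx)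
      obtain ⟨hiI, hiq⟩ := Finset.mem_filter.1 hi
      simp only [OneMemClass.coe_one, mul_one, Equiv.Perm.mul_apply]
      rwa [apply_eq_of_mem_blockGroup_colMu (e 1).2 hiI]
  · simp only [OneMemClass.coe_one, mul_one]
    exact hc i
  · simp only [Equiv.Perm.mul_apply]
    rw [hd, chi_apply_of_mem_blockGroup_colMu (e 1).2 i]

/-- **The bijective forth property** (Hall on the `|A|`-regular move multigraph), colours preserved because
the block group of a colour-refined type preserves colours. -/
theorem forth_colCarrier (hk : n.factorial * n ^ k ≤ 2 ^ (K * n) * Nat.card (classStab χ))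
    {p : Set (Fin n × Fin n)} (hp : p ∈ colCarrier K k G H c d χ) (hpk : p.ncard < k) :
    ∃ f : Fin n ≃ Fin n, ∀ a : Fin n, insert (a, f a) p ∈ colCarrier K k G H c d χ := by
  obtain ⟨I, -, β, γ, rfl, hR, hc, hd⟩ := hp
  rw [Set.ncard_coe_finset, Finset.card_image_of_injective _ (pebPair_injective β γ)] at hpk
  set A : Subgroup (Equiv.Perm (Fin n)) := blockGroup (colMu χ I) with hA
  -- one block move per new pebble slot
  have hT : ∀ s : Fin n, IsType K (blockGroup (colMu χ (insert s I))) := fun s =>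
    isType_blockGroup (isLowEntropy_colMu hk ((Finset.card_insert_le s I).trans (Nat.succ_le_of_lt hpk)))
  choose e he using fun s : Fin n => RelInf.step (hT s) hR
  -- the move multigraph: `(s, ρ)` joins `β (ρ s)` to `γ ((e s ρ) s)`
  let src : Fin n × A → Fin n := fun x => β ((x.2 : Equiv.Perm (Fin n)) x.1)
  let tgt : Fin n × A → Fin n := fun x => γ (((e x.1 x.2 : A) : Equiv.Perm (Fin n)) x.1)
  let t : Fin n → Finset (Fin n) := fun a => univ.filter fun b => ∃ x, src x = a ∧ tgt x = b
  have hsrc : ∀ a, (univ.filter fun x => src x = a).card = Fintype.card A := fun a =>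
    card_filter_apply_eq A β (fun _ => Equiv.refl A) a
  have htgt : ∀ b, (univ.filter fun x => tgt x = b).card = Fintype.card A := fun b =>
    card_filter_apply_eq A γ e b
  have hApos : 0 < Fintype.card A := Fintype.card_pos
  -- Hall's condition by double counting
  have hall : ∀ X : Finset (Fin n), X.card ≤ (X.biUnion t).card := by
    intro X
    have hsub : (univ.filter fun x => src x ∈ X) ⊆ univ.filter fun x => tgt x ∈ X.biUnion t := by
      intro x hx
      simp only [Finset.mem_filter, Finset.mem_univ, true_and] at hx ⊢
      exact Finset.mem_biUnion.2 ⟨src x, hx, Finset.mem_filter.2 ⟨Finset.mem_univ _, x, rfl, rfl⟩⟩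
    have h1 : (univ.filter fun x => src x ∈ X).card = X.card * Fintype.card A := by
      rw [Finset.card_eq_sum_card_fiberwise (f := src) (s := univ.filter fun x => src x ∈ X) (t := X)
        fun x hx => Finset.mem_coe.2 (Finset.mem_filter.1 (Finset.mem_coe.1 hx)).2,
        Finset.sum_const_nat (m := Fintype.card A)]
      intro a ha
      rw [← hsrc a, Finset.filter_filter]
      exact congrArg Finset.card (Finset.filter_congr fun x _ => ⟨fun h => h.2, fun h => ⟨by rw [h]; exact ha, h⟩⟩)
    have h2 : (univ.filter fun x => tgt x ∈ X.biUnion t).card = (X.biUnion t).card * Fintype.card A := by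
      rw [Finset.card_eq_sum_card_fiberwise (f := tgt) (s := univ.filter fun x => tgt x ∈ X.biUnion t)
        (t := X.biUnion t) fun x hx => Finset.mem_coe.2 (Finset.mem_filter.1 (Finset.mem_coe.1 hx)).2,
        Finset.sum_const_nat (m := Fintype.card A)]
      intro b hb
      rw [← htgt b, Finset.filter_filter]
      exact congrArg Finset.card (Finset.filter_congr fun x _ => ⟨fun h => h.2, fun h => ⟨by rw [h]; exact hb, h⟩⟩)
    have := Finset.card_le_card hsub
    rw [h1, h2] at this
    exact Nat.le_of_mul_le_mul_right this hApos
  obtain ⟨f, hf, hft⟩ := (Finset.all_card_le_biUnion_card_iff_exists_injective t).1 hall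
  refine ⟨Equiv.ofBijective f hf.bijective_of_finite, fun a => ?_⟩
  obtain ⟨⟨s, ρ⟩, hs, hb⟩ := (Finset.mem_filter.1 (hft a)).2
  simp only [Equiv.ofBijective_apply]
  refine ⟨insert s I, (Finset.card_insert_le s I).trans (Nat.succ_le_of_lt hpk), _, _, ?_, he s ρ,
    fun i => ?_, fun i => ?_⟩
  · rw [Finset.image_insert, Finset.coe_insert]
    congr 1
    · simp only [Equiv.Perm.mul_apply]
      exact Prod.ext hs.symm hb.symm
    · congr 1
      refine Finset.image_congr fun i hi => ?_
      simp only [Equiv.Perm.mul_apply]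
      rw [apply_eq_of_mem_blockGroup_colMu ρ.2 hi, apply_eq_of_mem_blockGroup_colMu (e s ρ).2 hi]
  · simp only [Equiv.Perm.mul_apply]
    rw [hc, chi_apply_of_mem_blockGroup_colMu ρ.2 i]
  · simp only [Equiv.Perm.mul_apply]
    rw [hd, chi_apply_of_mem_blockGroup_colMu (e s ρ).2 i]

/-- **The colour-respecting pebble strategy** of a limit-related pair of positions of the colour type
`colMu χ ∅` carrying `χ` to the vertex colourings `c`, `d`. -/
def colStrategy (hk : n.factorial * n ^ k ≤ 2 ^ (K * n) * Nat.card (classStab χ)) {β γ : Equiv.Perm (Fin n)}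
    (h : RelInf K (blockGroup (colMu χ ∅)) G β H γ) (hc : ∀ i, c (β i) = χ i) (hd : ∀ i, d (γ i) = χ i) :
    BijPebbleStrategy k G H where
  carrier := colCarrier K k G H c d χ
  empty_mem := ⟨∅, by simp, β, γ, by simp, h, hc, hd⟩
  finite_of_mem := by
    rintro p ⟨I, -, β, γ, rfl, -⟩
    exact Finset.finite_toSet _
  ncard_le_of_mem := by
    rintro p ⟨I, hI, β, γ, rfl, -⟩
    rw [Set.ncard_coe_finset]
    exact Finset.card_image_le.trans hI
  isPartialIso_of_mem := fun _ hp => isPartialIso_of_mem_colCarrier hp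
  mem_of_subset := fun _ hp _ hq => mem_colCarrier_of_subset hk hp hq
  forth := fun _ hp hpk => forth_colCarrier hk hp hpk

/-- The positions of `colStrategy` respect the colourings. -/
theorem colStrategy_colour (hk : n.factorial * n ^ k ≤ 2 ^ (K * n) * Nat.card (classStab χ))
    {β γ : Equiv.Perm (Fin n)} (h : RelInf K (blockGroup (colMu χ ∅)) G β H γ) (hc : ∀ i, c (β i) = χ i)
    (hd : ∀ i, d (γ i) = χ i) :
    ∀ p ∈ (colStrategy hk h hc hd).carrier, ∀ x ∈ p, c x.1 = d x.2 :=
  fun _ hp _ hx => colour_eq_of_mem_colCarrier hp hx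

end Strategy

/-! ### The theorems -/

/-- **Colouring robustness of the limit refinement** (position form): if the one-block positions
`β`, `γ` are limit-related and `c` is a colouring of `V(G)` with `n!·n^k ≤ 2^{Kn}·|classStab c|`, then
for some position `γ'` of `H` the coloured graphs `(G, c)` and `(H, c ∘ β ∘ γ'⁻¹)` admit a
colour-respecting bijective `k`-pebble strategy. -/
theorem exists_colourStrategy_of_relInf {k : ℕ} {G H : SimpleGraph (Fin n)} {β γ : Equiv.Perm (Fin n)}
    (h : RelInf K (blockGroup fun _ : Fin n => 0) G β H γ) (c : Fin n → ℕ)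
    (hc : n.factorial * n ^ k ≤ 2 ^ (K * n) * Nat.card (classStab c)) :
    ∃ γ' : Equiv.Perm (Fin n), ∃ S : BijPebbleStrategy k G H,
      ∀ p ∈ S.carrier, ∀ x ∈ p, c x.1 = c (β (γ'⁻¹ x.2)) := by
  -- slot colouring `χ := c ∘ β`; Duplicator answers the block move to the colour type
  set χ : Fin n → ℕ := fun i => c (β i) with hχ
  have hk : n.factorial * n ^ k ≤ 2 ^ (K * n) * Nat.card (classStab χ) := by
    rwa [hχ, card_classStab_comp_perm c β]
  have hT : IsType K (blockGroup (colMu χ ∅)) :=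
    isType_blockGroup (isLowEntropy_colMu hk (Finset.card_empty.le.trans (Nat.zero_le k)))
  obtain ⟨e, he⟩ := RelInf.step hT h
  have h1 : RelInf K (blockGroup (colMu χ ∅)) G β H (γ * e 1) := by
    have := he 1
    simpa only [OneMemClass.coe_one, mul_one] using this
  refine ⟨γ * e 1, colStrategy (c := c) (d := fun v => c (β ((γ * e 1)⁻¹ v))) (χ := χ) hk h1
    (fun i => rfl) (fun i => ?_), colStrategy_colour hk h1 _ _⟩
  show c (β ((γ * ↑(e 1))⁻¹ ((γ * ↑(e 1)) i))) = χ i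
  simp only [Equiv.Perm.coe_inv, Equiv.symm_apply_apply, hχ]

/-- **Colouring robustness of the entropy game**: an entropy-`K` game and a colouring `c` of `V(G)` with
`n!·n^k ≤ 2^{Kn}·|classStab c|` yield a vertex bijection `π` such that `(G, c)` and `(H, c ∘ π⁻¹)` admit
a colour-respecting bijective `k`-pebble strategy. -/
theorem exists_colourStrategy_of_entropyGame {k : ℕ} {G H : SimpleGraph (Fin n)}
    (g : Nonempty (EntropyGame K G H)) (c : Fin n → ℕ)
    (hc : n.factorial * n ^ k ≤ 2 ^ (K * n) * Nat.card (classStab c)) :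
    ∃ π : Equiv.Perm (Fin n), ∃ S : BijPebbleStrategy k G H,
      ∀ p ∈ S.carrier, ∀ x ∈ p, c x.1 = c (π.symm x.2) := by
  obtain ⟨β, γ, h⟩ := (nonempty_entropyGame_iff K G H).1 g
  obtain ⟨γ', S, hS⟩ := exists_colourStrategy_of_relInf h c hc
  refine ⟨γ' * β⁻¹, S, fun p hp x hx => ?_⟩
  rw [hS p hp x hx]
  simp [Equiv.Perm.mul_def, Equiv.Perm.inv_def]

/-- `n^{K₂ n / (log₂ n + 1)} ≤ 2^{K₂ n}`. -/
theorem pow_div_log_le_two_pow (n K₂ : ℕ) : n ^ (K₂ * n / (Nat.log 2 n + 1)) ≤ 2 ^ (K₂ * n) := by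
  set k := K₂ * n / (Nat.log 2 n + 1) with hk
  calc n ^ k ≤ (2 ^ (Nat.log 2 n + 1)) ^ k := Nat.pow_le_pow_left (Nat.lt_pow_succ_log_self one_lt_two n).le k
    _ = 2 ^ ((Nat.log 2 n + 1) * k) := by rw [← pow_mul]
    _ ≤ 2 ^ (K₂ * n) := Nat.pow_le_pow_right two_pos ?_
  calc (Nat.log 2 n + 1) * k = k * (Nat.log 2 n + 1) := mul_comm _ _
    _ ≤ K₂ * n := by rw [hk]; exact Nat.div_mul_le_self (K₂ * n) (Nat.log 2 n + 1)

/-- **Colouring robustness, logarithmic form**: an entropy-`(K₁ + K₂)` game survives every colouring of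
`V(G)` of entropy `≤ K₁ n` followed by `K₂ n / (log₂ n + 1)` bijective pebble rounds. -/
theorem colourRobust_of_entropyGame {K₁ K₂ : ℕ} {G H : SimpleGraph (Fin n)}
    (g : Nonempty (EntropyGame (K₁ + K₂) G H)) (c : Fin n → ℕ) (hc : IsLowEntropy K₁ c) :
    ∃ π : Equiv.Perm (Fin n), ∃ S : BijPebbleStrategy (K₂ * n / (Nat.log 2 n + 1)) G H,
      ∀ p ∈ S.carrier, ∀ x ∈ p, c x.1 = c (π.symm x.2) := by
  refine exists_colourStrategy_of_entropyGame g c ?_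
  rw [isLowEntropy_iff_card_classStab] at hc
  calc n.factorial * n ^ (K₂ * n / (Nat.log 2 n + 1))
      ≤ 2 ^ (K₁ * n) * Nat.card (classStab c) * 2 ^ (K₂ * n) := Nat.mul_le_mul hc (pow_div_log_le_two_pow n K₂)
    _ = 2 ^ ((K₁ + K₂) * n) * Nat.card (classStab c) := by rw [add_mul, pow_add]; ring

/-- **Spoiler's recipe** (contrapositive of `colourRobust_of_entropyGame`): to refute an entropy-`(K₁ + K₂)`
game it suffices to name ONE colouring `c` of `V(G)` of entropy `≤ K₁ n` such that, however it is transported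
to `V(H)` along a vertex bijection, the coloured graphs are separated in the colour-respecting bijective
`K₂ n / (log₂ n + 1)`-pebble game. -/
theorem not_nonempty_entropyGame_of_colouring {K₁ K₂ : ℕ} {G H : SimpleGraph (Fin n)} (c : Fin n → ℕ)
    (hc : IsLowEntropy K₁ c)
    (hsep : ∀ (π : Equiv.Perm (Fin n)) (S : BijPebbleStrategy (K₂ * n / (Nat.log 2 n + 1)) G H),
      ∃ p ∈ S.carrier, ∃ x ∈ p, c x.1 ≠ c (π.symm x.2)) :
    ¬ Nonempty (EntropyGame (K₁ + K₂) G H) := by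
  intro g
  obtain ⟨π, S, hS⟩ := colourRobust_of_entropyGame g c hc
  obtain ⟨p, hp, x, hx, hne⟩ := hsep π S
  exact hne (hS p hp x hx)

/-- **HardToIdentify forces colouring-robust high-dimensional Weisfeiler–Leman equivalence**: for all
`K₁ K₂`, infinitely often, two non-isomorphic `n`-vertex graphs `G`, `H` such that EVERY colouring `c` of
`V(G)` of entropy `≤ K₁ n` (e.g. every colouring with `≤ 2^{K₁}` colours, `isLowEntropy_of_lt_two_pow`)
is answered by a colouring `c ∘ π⁻¹` of `V(H)` with `(G, c)`, `(H, c ∘ π⁻¹)` equivalent in the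
colour-respecting bijective `K₂ n / (log₂ n + 1)`-pebble game.  (So Cai–Fürer–Immerman pairs, which are
separated by 3 pebbles once a section of the untwisted graph is coloured, are not witnesses.) -/
theorem colourRobust_of_hardToIdentify
    (hHTI : ∀ c : ℕ, ∃ᶠ h in atTop, ∃ H : SimpleGraph (Fin h),
      ¬ HasSymCircuit tcBasis Set.univ (2 ^ (c * h))
        (fun x : Fin h × Fin h → Bool =>
          decide (Nonempty ((SimpleGraph.fromRel fun u v => x (u, v) = true) ≃g H))))
    (K₁ K₂ : ℕ) :
    ∃ᶠ n in atTop, ∃ G H : SimpleGraph (Fin n), ¬ Nonempty (G ≃g H) ∧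
      ∀ c : Fin n → ℕ, IsLowEntropy K₁ c →
        ∃ π : Equiv.Perm (Fin n), ∃ S : BijPebbleStrategy (K₂ * n / (Nat.log 2 n + 1)) G H,
          ∀ p ∈ S.carrier, ∀ x ∈ p, c x.1 = c (π.symm x.2) :=
  (hardToIdentify_iff_entropyGames.1 hHTI (K₁ + K₂)).mono fun _ ⟨G, H, hGH, g⟩ =>
    ⟨G, H, hGH, fun c hc => colourRobust_of_entropyGame g c hc⟩

end

end CosetGame

end Summit.PneNP.PneNP.Theorems
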